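import Mathlib.Analysis.Calculus.ContDiff.Bounds
import HarnessLib

/-!
# Crux `AnchorGap` (stmt-QuantumFields-11141), line `registered` — PRODUCTS stay in GREP's observable
# class: `Π_{b∈X} G_b` is smooth with all derivatives of polynomial growth (step (G5) of the
# assembly of GREP, part: the product of the atom factors)

GREP (`stub_gaussianBBFPolymerRep`, `Cruxes/AnchorGap/Lines/birth.lean`) assumes atom-local factors
`G_b` that are `C^∞` with ALL iterated derivatives of polynomial growth,
`∀ n ∃ K m, ‖DⁿG_b(φ)‖ ≤ K (1 + Σᵢ φᵢ²)^m` (hypothesis text of GREP, never named here), and peels the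
expectation of the PRODUCT `Π_{b∈X} G_b`; ✓HEAT / the (G2) files of px19 g17 (`PolyGrowthClass`,
`CovLineDerivative`, `CovLineDop`, `CovLineIterate`) are stated for ONE member `H` of that class, so
the assembly needs the product to be a member — LOCATE-GREP (11141 evidence #28) (G5), first half.

* `polyBound_mul` — Leibniz (`norm_iteratedFDeriv_mul_le`): the class is closed under products,
  with `K = Σ_{i≤n} C(n,i)|K₁ i||K₂ (n−i)|`, `m = Σ_{i≤n} (m₁ i + m₂ (n−i))`;
* `polyBound_const` — constants are members (`iteratedFDeriv_const_of_ne`);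
* `contDiff_polyBound_prod` — `Π_{b∈X} G_b` is a member (Finset induction), in GREP's tokens
  `fun φ => ∏ b ∈ X, G b φ`.

[folklore] finite-dimensional calculus; no definition, no named fact.
-/

set_option autoImplicit false

namespace Summit.QuantumFields.YangMills.Theorems.AnchorGap.PolyGrowthProd

open Finset
open scoped ContDiff

variable {ι : Type} [Fintype ι]

/-- The polynomial-growth bounds on all derivatives survive products (Leibniz). [folklore] -/
theorem polyBound_mul {H₁ H₂ : (ι → ℝ) → ℝ} (h₁ : ContDiff ℝ (⊤ : ℕ∞) H₁)
    (h₂ : ContDiff ℝ (⊤ : ℕ∞) H₂)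
    (hb₁ : ∀ n : ℕ, ∃ (K : ℝ) (m : ℕ), ∀ φ : ι → ℝ,
      ‖iteratedFDeriv ℝ n H₁ φ‖ ≤ K * (1 + ∑ i, φ i ^ 2) ^ m)
    (hb₂ : ∀ n : ℕ, ∃ (K : ℝ) (m : ℕ), ∀ φ : ι → ℝ,
      ‖iteratedFDeriv ℝ n H₂ φ‖ ≤ K * (1 + ∑ i, φ i ^ 2) ^ m) :
    ∀ n : ℕ, ∃ (K : ℝ) (m : ℕ), ∀ φ : ι → ℝ,
      ‖iteratedFDeriv ℝ n (fun φ => H₁ φ * H₂ φ) φ‖ ≤ K * (1 + ∑ i, φ i ^ 2) ^ m := by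
  intro n
  choose K₁ m₁ hK₁ using hb₁
  choose K₂ m₂ hK₂ using hb₂
  refine ⟨∑ i ∈ Finset.range (n + 1), (n.choose i : ℝ) * |K₁ i| * |K₂ (n - i)|,
    ∑ i ∈ Finset.range (n + 1), (m₁ i + m₂ (n - i)), fun φ => ?_⟩
  set w : ℝ := 1 + ∑ i, φ i ^ 2 with hw
  have hw1 : 1 ≤ w := le_add_of_nonneg_right (Finset.sum_nonneg fun _ _ => sq_nonneg _)
  have hM : ∀ i ∈ Finset.range (n + 1), m₁ i + m₂ (n - i) ≤ ∑ i ∈ Finset.range (n + 1), (m₁ i + m₂ (n - i)) :=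
    fun i hi => Finset.single_le_sum (f := fun j => m₁ j + m₂ (n - j)) (fun j _ => Nat.zero_le _) hi
  refine (norm_iteratedFDeriv_mul_le h₁ h₂ φ (n := n) (by exact_mod_cast le_top)).trans ?_
  rw [Finset.sum_mul]
  refine Finset.sum_le_sum fun i hi => ?_
  have hn1 : 0 ≤ ‖iteratedFDeriv ℝ i H₁ φ‖ := norm_nonneg _
  have hn2 : 0 ≤ ‖iteratedFDeriv ℝ (n - i) H₂ φ‖ := norm_nonneg _
  have hb1 : ‖iteratedFDeriv ℝ i H₁ φ‖ ≤ |K₁ i| * w ^ m₁ i :=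
    (hK₁ i φ).trans (mul_le_mul_of_nonneg_right (le_abs_self _) (by positivity))
  have hb2 : ‖iteratedFDeriv ℝ (n - i) H₂ φ‖ ≤ |K₂ (n - i)| * w ^ m₂ (n - i) :=
    (hK₂ (n - i) φ).trans (mul_le_mul_of_nonneg_right (le_abs_self _) (by positivity))
  have hpow : w ^ m₁ i * w ^ m₂ (n - i) ≤ w ^ ∑ i ∈ Finset.range (n + 1), (m₁ i + m₂ (n - i)) := by
    rw [← pow_add]; exact pow_le_pow_right₀ hw1 (hM i hi)
  calc (n.choose i : ℝ) * ‖iteratedFDeriv ℝ i H₁ φ‖ * ‖iteratedFDeriv ℝ (n - i) H₂ φ‖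
      ≤ (n.choose i : ℝ) * (|K₁ i| * w ^ m₁ i) * (|K₂ (n - i)| * w ^ m₂ (n - i)) := by
        gcongr
    _ = (n.choose i : ℝ) * |K₁ i| * |K₂ (n - i)| * (w ^ m₁ i * w ^ m₂ (n - i)) := by ring
    _ ≤ (n.choose i : ℝ) * |K₁ i| * |K₂ (n - i)| * w ^ ∑ i ∈ Finset.range (n + 1), (m₁ i + m₂ (n - i)) :=
        mul_le_mul_of_nonneg_left hpow (by positivity)

/-- A constant has polynomially bounded derivatives. [folklore] -/
theorem polyBound_const (c : ℝ) : ∀ n : ℕ, ∃ (K : ℝ) (m : ℕ), ∀ φ : ι → ℝ,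
    ‖iteratedFDeriv ℝ n (fun _ : ι → ℝ => c) φ‖ ≤ K * (1 + ∑ i, φ i ^ 2) ^ m := by
  intro n
  refine ⟨‖c‖, 0, fun φ => ?_⟩
  rw [pow_zero, mul_one]
  rcases eq_or_ne n 0 with rfl | hn
  · rw [norm_iteratedFDeriv_zero]
  · rw [iteratedFDeriv_const_of_ne hn]; simp

/-- **A product of class members is in the class**: `Π_{b ∈ X} G_b` is smooth with all derivatives of
polynomial growth when every `G_b` is. [folklore] -/
theorem contDiff_polyBound_prod {β : Type} (X : Finset β) {G : β → (ι → ℝ) → ℝ}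
    (hG : ∀ b, ContDiff ℝ (⊤ : ℕ∞) (G b))
    (hGb : ∀ (b : β) (n : ℕ), ∃ (K : ℝ) (m : ℕ), ∀ φ : ι → ℝ,
      ‖iteratedFDeriv ℝ n (G b) φ‖ ≤ K * (1 + ∑ i, φ i ^ 2) ^ m) :
    ContDiff ℝ (⊤ : ℕ∞) (fun φ : ι → ℝ => ∏ b ∈ X, G b φ) ∧
      ∀ n : ℕ, ∃ (K : ℝ) (m : ℕ), ∀ φ : ι → ℝ,
        ‖iteratedFDeriv ℝ n (fun φ : ι → ℝ => ∏ b ∈ X, G b φ) φ‖ ≤ K * (1 + ∑ i, φ i ^ 2) ^ m := by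
  classical
  induction X using Finset.induction_on with
  | empty =>
    simp only [Finset.prod_empty]
    exact ⟨contDiff_const, polyBound_const 1⟩
  | insert b X hb ih =>
    simp only [Finset.prod_insert hb]
    exact ⟨(hG b).mul ih.1, polyBound_mul (hG b) ih.1 (hGb b) ih.2⟩

end Summit.QuantumFields.YangMills.Theorems.AnchorGap.PolyGrowthProd
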